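import Mathlib
import Literature.Analysis.PDE.FarKernelFamily
import Literature.Analysis.PDE.FarKernelSpan
import HarnessLib

/-!
# The comparison family `k_{α,β} = Σ α_m B⁰_m + Σ β_m B¹_m` of true kernel combinations

Analysis/PDE support file (everything proved). `exists_farKernelCombos`: for a potential of
inverse-square type, with the kernel family of `FarKernelFamily.lean`, every combination
`k_{α,β}(t,z) = Σ_{m≤n} α_m B⁰_m(t,z) + Σ_{m<n} β_m B¹_m(t,z)` is globally `C²`, solves
`k_tt − k_zz + P k = 0` on `{z ≥ 1}` with jointly continuous residual, is a `t`-polynomial on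
`{z ≥ 7/8}`, has finite, integrable and non-radiating exterior energy, and — when `α, β` vanish on
odd indices — its data are `K ε² (Σα_m² + Σβ_m²)`-close in `P`-energy on `(1,∞)` to the kernel datum
`(Σ α_m z^{m−n}, Σ β_m z^{m−n})`, with `K = K(n)` uniform in the potential. This is the comparison
space of the far-side channel estimate of `FixedModeChannels` (route PhotonSphereChannels,
stmt-FinalStateConjecture-10048). Folklore.
-/

noncomputable section

namespace Literature.Analysis.PDE

open MeasureTheory Set Filter Topology Finset Real

/-- **The comparison family.** See the module docstring. [folklore] -/
theorem exists_farKernelCombos (n : ℕ) :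
    ∃ K : ℝ, 0 ≤ K ∧ ∀ {P q : ℝ → ℝ} {ε : ℝ}, Continuous P → (∀ z, 0 ≤ P z) → Continuous q →
      0 ≤ ε → ε ≤ 1 / 64 → (∀ z, 3 / 8 ≤ z → P z = (n : ℝ) * (n + 1) / z ^ 2 + q z) →
      (∀ z, 3 / 8 ≤ z → |q z| ≤ ε * z ^ (-(5 : ℝ) / 2)) →
    ∃ B : ℕ → ℕ → ℝ → ℝ → ℝ, ∀ α β : ℕ → ℝ,
      let k : ℝ → ℝ → ℝ := fun t z =>
        ∑ m ∈ range (n + 1), α m * B 0 m t z + ∑ m ∈ range n, β m * B 1 m t z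
      ContDiff ℝ 2 (Function.uncurry k) ∧
      Continuous (fun p : ℝ × ℝ => iteratedDeriv 2 (fun τ => k τ p.2) p.1
        - iteratedDeriv 2 (k p.1) p.2 + P p.2 * k p.1 p.2) ∧
      (∀ t z, (1 : ℝ) ≤ z →
        iteratedDeriv 2 (fun τ => k τ z) t - iteratedDeriv 2 (k t) z + P z * k t z = 0) ∧
      (∃ (N : ℕ) (A : ℕ → ℝ → ℝ), ∀ t z, (7 / 8 : ℝ) ≤ z → k t z = ∑ i ∈ range N, A i z * t ^ i) ∧
      (∫⁻ z in Ioi 1, ENNReal.ofReal (deriv (fun τ => k τ z) 0 ^ 2 + deriv (k 0) z ^ 2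
        + P z * k 0 z ^ 2)) < ⊤ ∧
      (∀ t, IntegrableOn (fun z => deriv (fun τ => k τ z) t ^ 2 + deriv (k t) z ^ 2
        + P z * k t z ^ 2) (Ioi (1 + |t|))) ∧
      Tendsto (fun t => ∫ z in Ioi (1 + |t|),
        (deriv (fun τ => k τ z) t ^ 2 + deriv (k t) z ^ 2 + P z * k t z ^ 2)) atTop (𝓝 0) ∧
      Tendsto (fun t => ∫ z in Ioi (1 + |t|),
        (deriv (fun τ => k τ z) t ^ 2 + deriv (k t) z ^ 2 + P z * k t z ^ 2)) atBot (𝓝 0) ∧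
      ((∀ m, Odd m → α m = 0) → (∀ m, Odd m → β m = 0) →
        IntegrableOn (fun z =>
          (deriv (k 0) z - ∑ m ∈ range (n + 1), α m * ((m : ℝ) - n) * z ^ ((m : ℝ) - n - 1)) ^ 2
          + P z * (k 0 z - ∑ m ∈ range (n + 1), α m * z ^ ((m : ℝ) - n)) ^ 2
          + (deriv (fun τ => k τ z) 0 - ∑ m ∈ range n, β m * z ^ ((m : ℝ) - n)) ^ 2) (Ioi 1) ∧
        (∫ z in Ioi 1,
          ((deriv (k 0) z - ∑ m ∈ range (n + 1), α m * ((m : ℝ) - n) * z ^ ((m : ℝ) - n - 1)) ^ 2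
          + P z * (k 0 z - ∑ m ∈ range (n + 1), α m * z ^ ((m : ℝ) - n)) ^ 2
          + (deriv (fun τ => k τ z) 0 - ∑ m ∈ range n, β m * z ^ ((m : ℝ) - n)) ^ 2))
          ≤ K * ε ^ 2 * (∑ m ∈ range (n + 1), α m ^ 2 + ∑ m ∈ range n, β m ^ 2)) := by
  obtain ⟨Kf, hKf0, hKf⟩ := exists_farKernelFamily n
  refine ⟨(2 * n + 1) * Kf, by positivity, ?_⟩
  intro P q ε hPc hP0 hq hε hε1 hPq hqb
  obtain ⟨B, hB⟩ := hKf hPc hP0 hq hε hε1 hPq hqb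
  refine ⟨B, fun α β => ?_⟩
  intro k
  -- the combination as a single finite combination over `ℕ ⊕ ℕ`
  set u : Finset (ℕ ⊕ ℕ) := (range (n + 1)).disjSum (range n) with hu
  set a : ℕ ⊕ ℕ → ℝ := Sum.elim α β with ha
  set Bf : ℕ ⊕ ℕ → ℝ → ℝ → ℝ := Sum.elim (B 0) (B 1) with hBf
  have hkform : k = fun t z => ∑ x ∈ u, a x * Bf x t z := by
    funext t z
    simp only [hu, Finset.sum_disjSum, ha, hBf, Sum.elim_inl, Sum.elim_inr]
    rfl
  have hcard : (u.card : ℝ) = 2 * n + 1 := by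
    simp only [hu, Finset.card_disjSum, Finset.card_range]; push_cast; ring
  -- element facts
  have hfacts0 := fun m => hB 0 m (by norm_num)
  have hfacts1 := fun m => hB 1 m (by norm_num)
  have hC : ∀ x ∈ u, ContDiff ℝ 2 (Function.uncurry (Bf x)) := by
    rintro (m | m) _
    · exact (hfacts0 m).1
    · exact (hfacts1 m).1
  have heq : ∀ x ∈ u, ∀ t z, (1 : ℝ) ≤ z → iteratedDeriv 2 (fun τ => Bf x τ z) t
      - iteratedDeriv 2 (Bf x t) z + P z * Bf x t z = 0 := by
    rintro (m | m) _
    · exact (hfacts0 m).2.1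
    · exact (hfacts1 m).2.1
  have hst : ∀ x ∈ u, ∃ (N : ℕ) (A : ℕ → ℝ → ℝ), ∀ t z, (7 / 8 : ℝ) ≤ z →
      Bf x t z = ∑ i ∈ range N, A i z * t ^ i := by
    rintro (m | m) _
    · exact (hfacts0 m).2.2.1
    · exact (hfacts1 m).2.2.1
  have hEt : ∀ x ∈ u, ∀ t, IntegrableOn (fun z => deriv (fun τ => Bf x τ z) t ^ 2
      + deriv (Bf x t) z ^ 2 + P z * Bf x t z ^ 2) (Ioi (1 + |t|)) := by
    rintro (m | m) _
    · exact (hfacts0 m).2.2.2.2.2.2.1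
    · exact (hfacts1 m).2.2.2.2.2.2.1
  have htop : ∀ x ∈ u, Tendsto (fun t => ∫ z in Ioi (1 + |t|), (deriv (fun τ => Bf x τ z) t ^ 2
      + deriv (Bf x t) z ^ 2 + P z * Bf x t z ^ 2)) atTop (𝓝 0) := by
    rintro (m | m) _
    · exact (hfacts0 m).2.2.2.2.2.2.2.1
    · exact (hfacts1 m).2.2.2.2.2.2.2.1
  have hbot : ∀ x ∈ u, Tendsto (fun t => ∫ z in Ioi (1 + |t|), (deriv (fun τ => Bf x τ z) t ^ 2
      + deriv (Bf x t) z ^ 2 + P z * Bf x t z ^ 2)) atBot (𝓝 0) := by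
    rintro (m | m) _
    · exact (hfacts0 m).2.2.2.2.2.2.2.2
    · exact (hfacts1 m).2.2.2.2.2.2.2.2
  have hkC : ContDiff ℝ 2 (Function.uncurry k) := by rw [hkform]; exact contDiff_two_lincomb u a hC
  obtain ⟨hfin, hEk, hlimt, hlimb⟩ := lincomb_energies u hPc hP0 hC hEt htop hbot a hkform
  refine ⟨hkC, continuous_wave1D_residual hPc hkC, fun t z hz => ?_, ?_, hfin, hEk, hlimt, hlimb,
    fun hαo hβo => ?_⟩
  · rw [hkform]
    rw [wave1D_residual_lincomb u a P hC t z]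
    exact Finset.sum_eq_zero fun x hx => by rw [heq x hx t z hz, mul_zero]
  · rw [hkform]; exact lincomb_structure u hst a
  · -- closeness, with the indicator-weighted models of the family
    set f₀ : ℕ ⊕ ℕ → ℝ → ℝ := Sum.elim
      (fun m z => (if Even m ∧ m + 0 ≤ n then (1:ℝ) else 0) * (1 - ((0:ℕ):ℝ)) * z ^ ((m : ℝ) - n))
      (fun m z => (if Even m ∧ m + 1 ≤ n then (1:ℝ) else 0) * (1 - ((1:ℕ):ℝ)) * z ^ ((m : ℝ) - n))
      with hf₀
    set f₁ : ℕ ⊕ ℕ → ℝ → ℝ := Sum.elim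
      (fun m z => (if Even m ∧ m + 0 ≤ n then (1:ℝ) else 0) * (1 - ((0:ℕ):ℝ)) * ((m : ℝ) - n)
        * z ^ ((m : ℝ) - n - 1))
      (fun m z => (if Even m ∧ m + 1 ≤ n then (1:ℝ) else 0) * (1 - ((1:ℕ):ℝ)) * ((m : ℝ) - n)
        * z ^ ((m : ℝ) - n - 1)) with hf₁
    set g₀ : ℕ ⊕ ℕ → ℝ → ℝ := Sum.elim
      (fun m z => (if Even m ∧ m + 0 ≤ n then (1:ℝ) else 0) * ((0:ℕ):ℝ) * z ^ ((m : ℝ) - n))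
      (fun m z => (if Even m ∧ m + 1 ≤ n then (1:ℝ) else 0) * ((1:ℕ):ℝ) * z ^ ((m : ℝ) - n))
      with hg₀
    have hrpc : ∀ e : ℝ, ContinuousOn (fun z : ℝ => z ^ e) (Ioi 1) := fun e z hz =>
      (continuousAt_rpow_const _ _ (Or.inl (by
        have := Set.mem_Ioi.1 hz; linarith))).continuousWithinAt
    have hmodc : ∀ x ∈ u, ContinuousOn (f₀ x) (Ioi 1) ∧ ContinuousOn (f₁ x) (Ioi 1) ∧
        ContinuousOn (g₀ x) (Ioi 1) := by
      rintro (m | m) _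
      · exact ⟨continuousOn_const.mul (hrpc _), (continuousOn_const.mul (hrpc _)),
          continuousOn_const.mul (hrpc _)⟩
      · exact ⟨continuousOn_const.mul (hrpc _), (continuousOn_const.mul (hrpc _)),
          continuousOn_const.mul (hrpc _)⟩
    have hclI : ∀ x ∈ u, IntegrableOn (fun z => (deriv (Bf x 0) z - f₁ x z) ^ 2
        + P z * (Bf x 0 z - f₀ x z) ^ 2 + (deriv (fun τ => Bf x τ z) 0 - g₀ x z) ^ 2) (Ioi 1) := by
      rintro (m | m) _
      · exact (hfacts0 m).2.2.2.1
      · exact (hfacts1 m).2.2.2.1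
    have hcl : ∀ x ∈ u, (∫ z in Ioi 1, ((deriv (Bf x 0) z - f₁ x z) ^ 2
        + P z * (Bf x 0 z - f₀ x z) ^ 2 + (deriv (fun τ => Bf x τ z) 0 - g₀ x z) ^ 2)) ≤ Kf * ε ^ 2 := by
      rintro (m | m) _
      · exact (hfacts0 m).2.2.2.2.1
      · exact (hfacts1 m).2.2.2.2.1
    obtain ⟨hI, hbd⟩ := lincomb_closeness u hPc hP0 hC hmodc hclI hcl a hkform
    -- identify the combined models
    have hαe : ∀ m ∈ range (n + 1), α m * (if Even m ∧ m ≤ n then (1:ℝ) else 0) = α m := by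
      intro m hm
      by_cases h0 : α m = 0
      · simp [h0]
      · have he : Even m := by
          by_contra hne; exact h0 (hαo m (Nat.not_even_iff_odd.1 hne))
        rw [if_pos ⟨he, by have := mem_range.1 hm; omega⟩, mul_one]
    have hβe : ∀ m ∈ range n, β m * (if Even m ∧ m + 1 ≤ n then (1:ℝ) else 0) = β m := by
      intro m hm
      by_cases h0 : β m = 0
      · simp [h0]
      · have he : Even m := by
          by_contra hne; exact h0 (hβo m (Nat.not_even_iff_odd.1 hne))
        rw [if_pos ⟨he, by have := mem_range.1 hm; omega⟩, mul_one]
    have e₀ : ∀ z, ∑ x ∈ u, a x * f₀ x z = ∑ m ∈ range (n + 1), α m * z ^ ((m : ℝ) - n) := by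
      intro z
      simp only [hu, Finset.sum_disjSum, ha, hf₀, Sum.elim_inl, Sum.elim_inr, Nat.cast_zero,
        sub_zero, Nat.cast_one, sub_self, zero_mul, mul_zero, Finset.sum_const_zero, add_zero]
      refine Finset.sum_congr rfl fun m hm => ?_
      rw [mul_one, ← mul_assoc, hαe m hm]
    have e₁ : ∀ z, ∑ x ∈ u, a x * f₁ x z
        = ∑ m ∈ range (n + 1), α m * ((m : ℝ) - n) * z ^ ((m : ℝ) - n - 1) := by
      intro z
      simp only [hu, Finset.sum_disjSum, ha, hf₁, Sum.elim_inl, Sum.elim_inr, Nat.cast_zero,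
        sub_zero, Nat.cast_one, sub_self, zero_mul, mul_zero, Finset.sum_const_zero, add_zero]
      refine Finset.sum_congr rfl fun m hm => ?_
      rw [mul_one, ← mul_assoc, ← mul_assoc, hαe m hm]
    have e₂ : ∀ z, ∑ x ∈ u, a x * g₀ x z = ∑ m ∈ range n, β m * z ^ ((m : ℝ) - n) := by
      intro z
      simp only [hu, Finset.sum_disjSum, ha, hg₀, Sum.elim_inl, Sum.elim_inr, Nat.cast_zero,
        mul_zero, zero_mul, Finset.sum_const_zero, zero_add, Nat.cast_one, mul_one]
      refine Finset.sum_congr rfl fun m hm => ?_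
      rw [← mul_assoc, hβe m hm]
    have hsq : ∑ x ∈ u, a x ^ 2 = ∑ m ∈ range (n + 1), α m ^ 2 + ∑ m ∈ range n, β m ^ 2 := by
      simp only [hu, Finset.sum_disjSum, ha, Sum.elim_inl, Sum.elim_inr]
    simp only [e₀, e₁, e₂] at hI hbd
    rw [hcard, hsq] at hbd
    refine ⟨hI, hbd.trans (le_of_eq ?_)⟩
    ring

end Literature.Analysis.PDE
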